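import Mathlib
import HarnessLib
import Summits.RiemannHypothesis.RiemannHypothesis.Theorems.IntegerScrewWalkTwoLevelsPrep

/-!
# Route `IntegerScrew` — Gram-entry machinery for the COMPOSITE rungs: harmonic sums of products
# `Π_{p∈U}(u_p + v_p𝟙[p ∣ k])` over a finite set `U` of primes, their inclusion–exclusion expansion, and the
# `O(1)` bound when the `log M`-coefficient `Π_{p∈U}(u_p + v_p/p)` vanishes

Every product of parity functions `φ_S·φ_{S'}` (`φ_p = 1/p − 𝟙[p|k]`, `φ_p² = 1/p² + (1 − 2/p)𝟙[p|k]`) is of the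
form `Π_{p∈U}(u_p + v_p𝟙[p|k])` with `u_p + v_p/p = 0` at every `p ∈ S Δ S'`; so `sum_prod_add_indicator_div`
(**expansion**: `Σ_{k≤M} Π_p(u_p + v_p𝟙[p|k])/k = Σ_{T⊆U}(Π_{U∖T}u)(Π_T v)·H_{⌊M/ΠT⌋}/ΠT`) and
`abs_sum_prod_add_indicator_div_le` (**bound**: if `Π_p(u_p + v_p/p) = 0` then the sum is
`≤ Σ_T |Π_{U∖T}u||Π_Tv|(1 + log ΠT)/ΠT`, uniformly in `M`) give `⟨φ_S, φ_{S'}⟩_π = O(1)` for `S ≠ S'` — the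
remaining input of the K-rung scheme (`IntegerScrewWalkLevels`) for composite rungs `λ_S`, `|S| ≥ 2`
(CONTINUUM-LIMIT 23.18 (k),(l)).  RH-free.  Reference for the walk: M. Suzuki, J. Lond. Math. Soc. (2) 108 (2023)
1448–1487 [Suzuki2023] (PROP. N4 of the rh-explicit A6-PIVOT programme).
-/

noncomputable section

set_option linter.dupNamespace false -- D-0017: `Summit.<S>.<S>.…` is the designed namespace

namespace Summit.RiemannHypothesis.RiemannHypothesis.Theorems.IntegerScrew

open Finset ArithmeticFunction

/-- For a finite set `T` of primes, `(∀ p ∈ T, p ∣ k) ↔ Π_{p∈T} p ∣ k`. -/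
theorem forall_prime_dvd_iff_prod_dvd (T : Finset ℕ) (hT : ∀ p ∈ T, p.Prime) (k : ℕ) :
    (∀ p ∈ T, p ∣ k) ↔ (∏ p ∈ T, p) ∣ k :=
  ⟨fun h => Finset.prod_primes_dvd k (fun p hp => (hT p hp).prime) h,
   fun h _ hp => dvd_trans (Finset.dvd_prod_of_mem _ hp) h⟩

/-- **Inclusion–exclusion expansion**: for a finite set `U` of primes and coefficients `u, v`,
`Σ_{k≤M} Π_{p∈U}(u_p + v_p·𝟙[p ∣ k])/k = Σ_{T⊆U} (Π_{p∈U∖T}u_p)(Π_{p∈T}v_p)·(1/ΠT)·H_{⌊M/ΠT⌋}`. -/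
theorem sum_prod_add_indicator_div (U : Finset ℕ) (hU : ∀ p ∈ U, p.Prime) (u v : ℕ → ℝ) (M : ℕ) :
    ∑ k ∈ Icc 1 M, (∏ p ∈ U, (u p + v p * (if p ∣ k then 1 else 0))) / (k : ℝ) =
      ∑ T ∈ U.powerset, (∏ p ∈ U \ T, u p) * (∏ p ∈ T, v p) *
        ((1 / ((∏ p ∈ T, p : ℕ) : ℝ)) * ∑ n ∈ Icc 1 (M / ∏ p ∈ T, p), (1 : ℝ) / n) := by
  classical
  have e : ∀ k ∈ Icc 1 M, (∏ p ∈ U, (u p + v p * (if p ∣ k then 1 else 0))) / (k : ℝ) =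
      ∑ T ∈ U.powerset, (∏ p ∈ U \ T, u p) * (∏ p ∈ T, v p) *
        (if (∏ p ∈ T, p) ∣ k then 1 / (k : ℝ) else 0) := by
    intro k _
    rw [show (∏ p ∈ U, (u p + v p * (if p ∣ k then (1 : ℝ) else 0))) =
        ∏ p ∈ U, (v p * (if p ∣ k then (1 : ℝ) else 0) + u p) from
      Finset.prod_congr rfl fun p _ => add_comm _ _]
    rw [Finset.prod_add, Finset.sum_div]
    refine Finset.sum_congr rfl fun T hT => ?_
    have hTU : T ⊆ U := Finset.mem_powerset.1 hT
    rw [Finset.prod_mul_distrib, Finset.prod_boole]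
    have hiff : (∀ p ∈ T, p ∣ k) ↔ (∏ p ∈ T, p) ∣ k :=
      forall_prime_dvd_iff_prod_dvd T (fun p hp => hU p (hTU hp)) k
    by_cases hd : (∏ p ∈ T, p) ∣ k
    · rw [if_pos (hiff.2 hd), if_pos hd]; ring
    · rw [if_neg (fun h => hd (hiff.1 h)), if_neg hd]; ring
  rw [Finset.sum_congr rfl e, Finset.sum_comm]
  refine Finset.sum_congr rfl fun T hT => ?_
  rw [← Finset.mul_sum, ← Finset.sum_filter]
  have hTU : T ⊆ U := Finset.mem_powerset.1 hT
  have h1 : 1 ≤ ∏ p ∈ T, p :=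
    Nat.one_le_iff_ne_zero.2 (Finset.prod_ne_zero_iff.2 fun p hp => (hU p (hTU hp)).ne_zero)
  rw [sum_inv_multiples_eq h1]

/-- The `log M`-coefficient of the expansion: `Σ_{T⊆U} (Π_{U∖T}u)(Π_T v)/ΠT = Π_{p∈U}(u_p + v_p/p)`. -/
theorem sum_powerset_prod_div_eq (U : Finset ℕ) (u v : ℕ → ℝ) :
    ∑ T ∈ U.powerset, (∏ p ∈ U \ T, u p) * (∏ p ∈ T, v p) * (1 / ((∏ p ∈ T, p : ℕ) : ℝ)) =
      ∏ p ∈ U, (u p + v p / p) := by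
  classical
  rw [show (∏ p ∈ U, (u p + v p / p)) = ∏ p ∈ U, (v p / p + u p) from
    Finset.prod_congr rfl fun p _ => add_comm _ _, Finset.prod_add]
  refine Finset.sum_congr rfl fun T _ => ?_
  rw [Finset.prod_div_distrib]
  push_cast
  ring

/-- **The `O(1)` bound.**  If `Π_{p∈U}(u_p + v_p/p) = 0` (no `log M` term), then uniformly in `M`
`|Σ_{k≤M} Π_p(u_p + v_p𝟙[p|k])/k| ≤ Σ_{T⊆U} |Π_{U∖T}u_p|·|Π_Tv_p|·(1 + log ΠT)/ΠT`
(each `H_M − H_{⌊M/d⌋} ∈ [0, 1 + log d]`, `harmonic_sub_harmonic_div_bounds`). -/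
theorem abs_sum_prod_add_indicator_div_le (U : Finset ℕ) (hU : ∀ p ∈ U, p.Prime) (u v : ℕ → ℝ) (M : ℕ)
    (h0 : ∏ p ∈ U, (u p + v p / p) = 0) :
    |∑ k ∈ Icc 1 M, (∏ p ∈ U, (u p + v p * (if p ∣ k then 1 else 0))) / (k : ℝ)| ≤
      ∑ T ∈ U.powerset, |∏ p ∈ U \ T, u p| * |∏ p ∈ T, v p| *
        ((1 + Real.log ((∏ p ∈ T, p : ℕ) : ℝ)) / ((∏ p ∈ T, p : ℕ) : ℝ)) := by
  classical
  rw [sum_prod_add_indicator_div U hU u v M]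
  set H : ℝ := ∑ k ∈ Icc 1 M, (1 : ℝ) / k with hH
  -- subtract the vanishing log-coefficient times H_M
  have hzero : ∑ T ∈ U.powerset, (∏ p ∈ U \ T, u p) * (∏ p ∈ T, v p) *
      ((1 / ((∏ p ∈ T, p : ℕ) : ℝ)) * H) = 0 := by
    have e : ∀ T ∈ U.powerset, (∏ p ∈ U \ T, u p) * (∏ p ∈ T, v p) * ((1 / ((∏ p ∈ T, p : ℕ) : ℝ)) * H) =
        H * ((∏ p ∈ U \ T, u p) * (∏ p ∈ T, v p) * (1 / ((∏ p ∈ T, p : ℕ) : ℝ))) := by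
      intro T _; ring
    rw [Finset.sum_congr rfl e, ← Finset.mul_sum, sum_powerset_prod_div_eq, h0, mul_zero]
  have esub : ∑ T ∈ U.powerset, (∏ p ∈ U \ T, u p) * (∏ p ∈ T, v p) *
        ((1 / ((∏ p ∈ T, p : ℕ) : ℝ)) * ∑ n ∈ Icc 1 (M / ∏ p ∈ T, p), (1 : ℝ) / n) =
      ∑ T ∈ U.powerset, -((∏ p ∈ U \ T, u p) * (∏ p ∈ T, v p) *
        ((1 / ((∏ p ∈ T, p : ℕ) : ℝ)) * (H - ∑ n ∈ Icc 1 (M / ∏ p ∈ T, p), (1 : ℝ) / n))) := by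
    rw [← sub_zero (∑ T ∈ U.powerset, (∏ p ∈ U \ T, u p) * (∏ p ∈ T, v p) *
        ((1 / ((∏ p ∈ T, p : ℕ) : ℝ)) * ∑ n ∈ Icc 1 (M / ∏ p ∈ T, p), (1 : ℝ) / n)), ← hzero,
      ← Finset.sum_sub_distrib]
    exact Finset.sum_congr rfl fun T _ => by ring
  rw [esub]
  refine (Finset.abs_sum_le_sum_abs _ _).trans (Finset.sum_le_sum fun T hT => ?_)
  have hTU : T ⊆ U := Finset.mem_powerset.1 hT
  have h1 : 1 ≤ ∏ p ∈ T, p :=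
    Nat.one_le_iff_ne_zero.2 (Finset.prod_ne_zero_iff.2 fun p hp => (hU p (hTU hp)).ne_zero)
  have hd0 : (0 : ℝ) < ((∏ p ∈ T, p : ℕ) : ℝ) := by exact_mod_cast h1
  have hb := harmonic_sub_harmonic_div_bounds h1 M
  rw [← hH] at hb
  rw [abs_neg, abs_mul, abs_mul, abs_mul, abs_of_pos (one_div_pos.2 hd0),
    abs_of_nonneg hb.1]
  have hcoef : 0 ≤ |∏ p ∈ U \ T, u p| * |∏ p ∈ T, v p| := by positivity
  calc |∏ p ∈ U \ T, u p| * |∏ p ∈ T, v p| *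
        (1 / ((∏ p ∈ T, p : ℕ) : ℝ) * (H - ∑ n ∈ Icc 1 (M / ∏ p ∈ T, p), (1 : ℝ) / n))
      ≤ |∏ p ∈ U \ T, u p| * |∏ p ∈ T, v p| *
        (1 / ((∏ p ∈ T, p : ℕ) : ℝ) * (1 + Real.log ((∏ p ∈ T, p : ℕ) : ℝ))) :=
        mul_le_mul_of_nonneg_left (mul_le_mul_of_nonneg_left hb.2 (one_div_pos.2 hd0).le) hcoef
    _ = |∏ p ∈ U \ T, u p| * |∏ p ∈ T, v p| *
        ((1 + Real.log ((∏ p ∈ T, p : ℕ) : ℝ)) / ((∏ p ∈ T, p : ℕ) : ℝ)) := by ring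

/-! ### Specialisation to products of parity functions -/

/-- The pointwise factorisation `φ_S(k)·φ_{S'}(k) = Π_{p∈S∪S'}(u_p + v_p𝟙[p∣k])` with
`(u_p, v_p) = (1/p², 1 − 2/p)` on `S ∩ S'` and `(1/p, −1)` on `S Δ S'`. -/
theorem prod_parityFun_mul_prod_eq (S S' : Finset ℕ) (k : ℕ) :
    (∏ p ∈ S, parityFun p k) * ∏ p ∈ S', parityFun p k =
      ∏ p ∈ S ∪ S', ((if p ∈ S ∩ S' then 1 / (p : ℝ) ^ 2 else 1 / (p : ℝ)) +
        (if p ∈ S ∩ S' then 1 - 2 / (p : ℝ) else -1) * (if p ∣ k then 1 else 0)) := by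
  classical
  -- both sides equal Π_{S∪S'} φ_p · Π_{S∩S'} φ_p
  rw [← Finset.prod_union_inter]
  have hinter : ∏ p ∈ S ∩ S', parityFun p k = ∏ p ∈ S ∪ S', (if p ∈ S ∩ S' then parityFun p k else 1) := by
    rw [← Finset.prod_filter]
    congr 1
    ext p; simp only [Finset.mem_filter, Finset.mem_union, Finset.mem_inter]; tauto
  rw [hinter, ← Finset.prod_mul_distrib]
  refine Finset.prod_congr rfl fun p _ => ?_
  by_cases hm : p ∈ S ∩ S'
  · rw [if_pos hm, if_pos hm, if_pos hm]
    by_cases hd : p ∣ k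
    · rw [parityFun_of_dvd hd, if_pos hd]; field_simp; ring
    · rw [parityFun_of_not_dvd hd, if_neg hd]; field_simp; ring
  · rw [if_neg hm, if_neg hm, if_neg hm, mul_one]
    by_cases hd : p ∣ k
    · rw [parityFun_of_dvd hd, if_pos hd]; field_simp; ring
    · rw [parityFun_of_not_dvd hd, if_neg hd]; ring

/-- **Off-diagonal Gram entries are `O(1)`**: for finite sets of primes `S ≠ S'` and every `M`,
`|Σ_{k≤M} φ_S(k)φ_{S'}(k)/k| ≤ 2^{|S ∪ S'|}` (the `log M`-coefficient vanishes at any `p ∈ S Δ S'`). -/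
theorem abs_sum_prod_parityFun_mul_div_le (S S' : Finset ℕ) (hS : ∀ p ∈ S, p.Prime) (hS' : ∀ p ∈ S', p.Prime)
    (hne : S ≠ S') (M : ℕ) :
    |∑ k ∈ Icc 1 M, (∏ p ∈ S, parityFun p k) * (∏ p ∈ S', parityFun p k) / (k : ℝ)| ≤
      (2 : ℝ) ^ (S ∪ S').card := by
  classical
  have hU : ∀ p ∈ S ∪ S', p.Prime := fun p hp => by
    rcases Finset.mem_union.1 hp with h | h
    · exact hS p h
    · exact hS' p h
  set u : ℕ → ℝ := fun p => if p ∈ S ∩ S' then 1 / (p : ℝ) ^ 2 else 1 / (p : ℝ) with hu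
  set v : ℕ → ℝ := fun p => if p ∈ S ∩ S' then 1 - 2 / (p : ℝ) else -1 with hv
  have e : ∀ k ∈ Icc 1 M, (∏ p ∈ S, parityFun p k) * (∏ p ∈ S', parityFun p k) / (k : ℝ) =
      (∏ p ∈ S ∪ S', (u p + v p * (if p ∣ k then 1 else 0))) / (k : ℝ) := by
    intro k _; rw [prod_parityFun_mul_prod_eq]
  rw [Finset.sum_congr rfl e]
  -- the log-coefficient vanishes: pick p ∈ S Δ S'
  have h0 : ∏ p ∈ S ∪ S', (u p + v p / p) = 0 := by
    have hex : ∃ p ∈ S ∪ S', p ∉ S ∩ S' := by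
      by_contra hall
      have hall : ∀ p ∈ S ∪ S', p ∈ S ∩ S' := fun p hp => by
        by_contra h; exact hall ⟨p, hp, h⟩
      apply hne
      ext p
      constructor
      · intro hp; exact (Finset.mem_inter.1 (hall p (Finset.mem_union_left _ hp))).2
      · intro hp; exact (Finset.mem_inter.1 (hall p (Finset.mem_union_right _ hp))).1
    obtain ⟨p, hpU, hpn⟩ := hex
    refine Finset.prod_eq_zero hpU ?_
    have hp0 : (p : ℝ) ≠ 0 := by exact_mod_cast (hU p hpU).ne_zero
    rw [hu, hv]; dsimp only
    rw [if_neg hpn, if_neg hpn]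
    field_simp
    ring
  refine (abs_sum_prod_add_indicator_div_le (S ∪ S') hU u v M h0).trans ?_
  -- each term ≤ 1: |u_p|, |v_p| ≤ 1 and (1 + log d)/d ≤ 1
  have hu1 : ∀ p ∈ S ∪ S', |u p| ≤ 1 := by
    intro p hp
    have h2 : (2 : ℝ) ≤ p := by exact_mod_cast (hU p hp).two_le
    rw [hu]; dsimp only
    split_ifs
    · rw [abs_of_nonneg (by positivity), div_le_one (by positivity)]; nlinarith
    · rw [abs_of_nonneg (by positivity), div_le_one (by positivity)]; linarith
  have hv1 : ∀ p ∈ S ∪ S', |v p| ≤ 1 := by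
    intro p hp
    have h2 : (2 : ℝ) ≤ p := by exact_mod_cast (hU p hp).two_le
    have hp0 : (0 : ℝ) < p := by linarith
    rw [hv]; dsimp only
    split_ifs
    · have : 0 ≤ 1 - 2 / (p : ℝ) := by rw [sub_nonneg, div_le_one hp0]; exact h2
      rw [abs_of_nonneg this]
      have : 0 ≤ 2 / (p : ℝ) := by positivity
      linarith
    · simp
  have hterm : ∀ T ∈ (S ∪ S').powerset, |∏ p ∈ (S ∪ S') \ T, u p| * |∏ p ∈ T, v p| *
      ((1 + Real.log ((∏ p ∈ T, p : ℕ) : ℝ)) / ((∏ p ∈ T, p : ℕ) : ℝ)) ≤ 1 := by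
    intro T hT
    have hTU : T ⊆ S ∪ S' := Finset.mem_powerset.1 hT
    have h1 : |∏ p ∈ (S ∪ S') \ T, u p| ≤ 1 := by
      rw [Finset.abs_prod]
      exact Finset.prod_le_one (fun p _ => abs_nonneg _) fun p hp => hu1 p (Finset.mem_sdiff.1 hp).1
    have h2 : |∏ p ∈ T, v p| ≤ 1 := by
      rw [Finset.abs_prod]
      exact Finset.prod_le_one (fun p _ => abs_nonneg _) fun p hp => hv1 p (hTU hp)
    have hd1 : (1 : ℝ) ≤ ((∏ p ∈ T, p : ℕ) : ℝ) := by
      exact_mod_cast Nat.one_le_iff_ne_zero.2 (Finset.prod_ne_zero_iff.2 fun p hp => (hU p (hTU hp)).ne_zero)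
    have h3 : (1 + Real.log ((∏ p ∈ T, p : ℕ) : ℝ)) / ((∏ p ∈ T, p : ℕ) : ℝ) ≤ 1 := by
      rw [div_le_one (by linarith)]
      linarith [Real.log_le_sub_one_of_pos (by linarith : (0 : ℝ) < ((∏ p ∈ T, p : ℕ) : ℝ))]
    have h3' : 0 ≤ (1 + Real.log ((∏ p ∈ T, p : ℕ) : ℝ)) / ((∏ p ∈ T, p : ℕ) : ℝ) :=
      div_nonneg (by linarith [Real.log_nonneg hd1]) (by linarith)
    calc |∏ p ∈ (S ∪ S') \ T, u p| * |∏ p ∈ T, v p| *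
          ((1 + Real.log ((∏ p ∈ T, p : ℕ) : ℝ)) / ((∏ p ∈ T, p : ℕ) : ℝ))
        ≤ 1 * 1 * 1 := by
          apply mul_le_mul (mul_le_mul h1 h2 (abs_nonneg _) zero_le_one) h3 h3' (by positivity)
      _ = 1 := by ring
  refine (Finset.sum_le_sum hterm).trans ?_
  rw [Finset.sum_const, Finset.card_powerset, nsmul_eq_mul, mul_one]
  push_cast
  exact le_rfl

/-- **Means are `O(1)`**: for a non-empty finite set `S` of primes, `|Σ_{k≤M} φ_S(k)/k| ≤ 2^{|S|}`. -/
theorem abs_sum_prod_parityFun_div_le (S : Finset ℕ) (hS : ∀ p ∈ S, p.Prime) (hne : S.Nonempty) (M : ℕ) :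
    |∑ k ∈ Icc 1 M, (∏ p ∈ S, parityFun p k) / (k : ℝ)| ≤ (2 : ℝ) ^ S.card := by
  have h := abs_sum_prod_parityFun_mul_div_le S ∅ hS (by simp) (Finset.Nonempty.ne_empty hne) M
  simp only [Finset.prod_empty, mul_one, Finset.union_empty] at h
  exact h

/-- **Diagonal Gram entries grow like `H_M`**: `Σ_{k≤M} φ_S(k)²/k ≥ H_M/Π_{p∈S}p²`. -/
theorem sum_prod_parityFun_sq_div_ge (S : Finset ℕ) (hS : ∀ p ∈ S, p.Prime) (M : ℕ) :
    (∑ k ∈ Icc 1 M, (1 : ℝ) / k) / ∏ p ∈ S, (p : ℝ) ^ 2 ≤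
      ∑ k ∈ Icc 1 M, (∏ p ∈ S, parityFun p k) * (∏ p ∈ S, parityFun p k) / (k : ℝ) := by
  rw [Finset.sum_div]
  refine Finset.sum_le_sum fun k _ => ?_
  have hsq : 1 / ∏ p ∈ S, (p : ℝ) ^ 2 ≤ (∏ p ∈ S, parityFun p k) * ∏ p ∈ S, parityFun p k := by
    rw [← Finset.prod_mul_distrib, one_div, ← Finset.prod_inv_distrib]
    refine Finset.prod_le_prod (fun p _ => by positivity) fun p hp => ?_
    have h2 : (2 : ℝ) ≤ p := by exact_mod_cast (hS p hp).two_le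
    by_cases hd : p ∣ k
    · rw [parityFun_of_dvd hd]
      have h1 : (p : ℝ)⁻¹ ≤ 1 - (p : ℝ)⁻¹ := by
        rw [inv_eq_one_div]
        have : 1 / (p : ℝ) ≤ 1 / 2 := one_div_le_one_div_of_le (by norm_num) h2
        linarith
      calc ((p : ℝ) ^ 2)⁻¹ = (p : ℝ)⁻¹ * (p : ℝ)⁻¹ := by rw [sq, mul_inv]
        _ ≤ (1 - (p : ℝ)⁻¹) * (1 - (p : ℝ)⁻¹) := mul_le_mul h1 h1 (by positivity) (by linarith [h1])
        _ = -(1 - (p : ℝ)⁻¹) * -(1 - (p : ℝ)⁻¹) := by ring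
    · rw [parityFun_of_not_dvd hd, sq, mul_inv]
  have hk : (0 : ℝ) ≤ 1 / (k : ℝ) := by positivity
  calc 1 / (k : ℝ) / ∏ p ∈ S, (p : ℝ) ^ 2 = (1 / ∏ p ∈ S, (p : ℝ) ^ 2) * (1 / (k : ℝ)) := by ring
    _ ≤ ((∏ p ∈ S, parityFun p k) * ∏ p ∈ S, parityFun p k) * (1 / (k : ℝ)) :=
        mul_le_mul_of_nonneg_right hsq hk
    _ = (∏ p ∈ S, parityFun p k) * (∏ p ∈ S, parityFun p k) / (k : ℝ) := by ring

end Summit.RiemannHypothesis.RiemannHypothesis.Theorems.IntegerScrew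

end
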